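import Literature.MathematicalPhysics.QuantumFieldTheory.Balaban1983to89.B14BoxFix

/-!
# `Balaban1983to89.B14BoxFixWall` — the box replacement of [III] pp. 251/269 vs (2.3), WALL-connectivity reading
(cell `GAPS.md` G-adv5-9 (wall variant), C-B14s-13; `DIVERGENCE.md` D-pv02.17)

CITATION HEADER (lean-in-tree rule 2026-08-18).  Source: T. Bałaban, *Convergent renormalization expansions for
lattice gauge theories*, Commun. Math. Phys. **119**, 243–285 (1988) [Balaban1988Convergent] (cell paper B14 =
[III]), pp. 251, 255, 269; quotations read by the typist on the x2 renders `…-p009`, `…-p013`, `…-p027` of the cell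
folder `b2b-balaban-ref1/pages/1988-cmp119-convergent-renormalization/` (the same three sentences as in
`…B14BoxFix`, repeated here so that the module carries its own text).  The paper is a manuscript UNDER
ADJUDICATION by the audit cell `pub-balaban`: NOTHING printed in it is asserted here; every `theorem` below is
elementary and proved without `sorry` or new axioms.  NEW sibling module of unit `b2b-balaban-pv02` (gen 3,
journal claim G-adv5-9-WALL-KERNEL); it imports `…B14BoxFix` (pv02) and modifies nothing.

THE PRINTED TEXT (verbatim).
* p. 251 [PDF 9]: *"We distinguish components which are contained in cubes of sizes smaller than 100LMR₁, and we
  replace such components by the smallest rectangular parallelepipeds containing them."*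
* p. 255 [PDF 13], (2.3): *"if a component of Z_j is contained in a cube of the size 100MR_j (in the
  L^{−j}-lattice), then it is a rectangular parallelepiped."*
* p. 269 [PDF 27]: *"we consider components of Λᶜ_{k+1}, and if a component is contained in a cube of the size
  100LMR_{k+1}, then we replace it by the smallest rectangular parallelepiped containing it."*

THE REFEREE'S WALL VARIANT (cell GAPS.md G-adv5-9, `b2b-balaban-adv5` gen 5, quoted as the referee's text, not the
paper's): *"Under wall-connectivity take instead the fourth cube at (6,3,0,0): K₂ = [5,7]×[2,4]×[−1,1]²,
wall-disjoint from K₁ before the pass ((4,1) vs (5,2) share only an edge), wall-adjacent to box(K₁) after it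
((4,2)|(5,2)) — same failure."*

THE MODEL.  As in `…B14BoxFix` (cube indices `c ∈ ℤ^d`, `ibox`, `bbox`, `FitsIn`, cell DIVERGENCE.md D-pv02.17),
but with «component» read as WALL-component (`…B14Components.WConn` / `wComp`: chains of cubes, consecutive ones
sharing a `(d−1)`-face; [I] p. 257 wording, cell GAPS C-adv5-15 / DIVERGENCE D-adv5.8): `passW N Z` adjoins the
bounding boxes of the small WALL-components, `Cond23W N Z` is (2.3) for WALL-components.

WHAT IS KERNEL-CHECKED.  (A) Boxes are wall-connected (`ibox_wconn`: walk one coordinate at a time, `slide`,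
`fixBelow`).  (B) At a fixpoint of `passW`, `Cond23W` holds (`cond23W_of_fixpoint`); the iterated pass
`(passW N)^[#A] Z` inside any box `A ⊇ Z` is a fixpoint containing `Z` and satisfies `Cond23W`
(`passW_iterate_fixpoint`, `cond23W_iterate`, by the generic `…B14BoxFix.iterate_fix`) — the referee's repair, wall
reading.  (C) A SINGLE PASS FAILS in the wall reading too (`d = 2` slice of the referee's wall example): with `K1`
the L of `…B14BoxFix` (enlargement of `(0,0),(0,3),(3,0)`) and `K2w = [5,7]×[2,4]` (enlargement of `(6,3)`,
`K2w_eq_ienl`), the wall-components of `Z0w = K1 ∪ K2w` are `K1` and `K2w` (`wComp_Z0w_of_mem_K1`,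
`wComp_Z0w_of_mem_K2w`; the cubes `(4,1)` and `(5,2)` only touch at a corner, `corner_41_52`), one pass gives
`Z1w = [−1,4]² ∪ [5,7]×[2,4]` (`passW_Z0w`, `N ≥ 6`), in which `(4,2)` and `(5,2)` share a wall: ONE wall-component
(`wComp_Z1w`), inside a `9`-cube, not a box (`Z1w_not_box`); hence `¬ Cond23W N (passW N Z0w)` for all `N ≥ 9`
(`single_passW_fails`).  Together with `…B14BoxFix.single_pass_fails` the referee's objection G-adv5-9 /
G-adv5-11 (i) and its repair are kernel facts under BOTH connectivity readings in use in the cell.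

WHAT IS *NOT* ASSERTED: which reading of «component» or of «replace» the author intends (D-adv5.8, D-pv02.16,
D-pv02.17); anything about bounds; realisability of `K1`, `K2w` as an actual `Λ₁ᶜ`.  Note that in the TOUCHING
reading `Z0w` is already one component (`corner_41_52`), so the wall example is specific to the wall reading, as
the touching example of `…B14BoxFix` (corner contact `(4,4)/(5,5)` only after the pass) is to the touching one.
Value = kernel certificate for a referee objection and its repair, NOT summit progress.  Companion rows: cell
`GAPS.md` C-B14s-13; `DIVERGENCE.md` D-pv02.17.
-/

namespace Literature.MathematicalPhysics.QuantumFieldTheory.Balaban1983to89.B14BoxFixWall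

open Literature.MathematicalPhysics.QuantumFieldTheory.Balaban1983to89.B14DomainGeom
open Literature.MathematicalPhysics.QuantumFieldTheory.Balaban1983to89.B14Components
open Literature.MathematicalPhysics.QuantumFieldTheory.Balaban1983to89.B14BoxFix

variable {d : ℕ}

/-! ## A. Boxes are wall-connected: walk one coordinate at a time -/

/-- Move coordinate `i` of `a` toward `b i` by at most `n`, the other coordinates unchanged. [folklore] -/
def slide (a b : Pt d) (i : Fin d) (n : ℕ) : Pt d :=
  fun j => if j = i then a j + max (-(n : ℤ)) (min (n : ℤ) (b j - a j)) else a j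

/-- `a` with coordinate `i` set to `b i`. [folklore] -/
def setI (a b : Pt d) (i : Fin d) : Pt d := fun j => if j = i then b j else a j

/-- `a` with the coordinates of index `< k` set to those of `b`. [folklore] -/
def fixBelow (a b : Pt d) (k : ℕ) : Pt d := fun j => if (j : ℕ) < k then b j else a j

/-- [folklore] -/
theorem slide_zero (a b : Pt d) (i : Fin d) : slide a b i 0 = a := by
  funext j
  unfold slide
  split_ifs with h
  · simp only [Nat.cast_zero, neg_zero]
    rw [max_def, min_def]
    split_ifs <;> omega
  · rfl

/-- [folklore] -/
theorem slide_of_le (a b : Pt d) (i : Fin d) {n : ℕ} (h : |b i - a i| ≤ n) : slide a b i n = setI a b i := by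
  funext j
  unfold slide setI
  split_ifs with hj
  · subst hj
    have h' := abs_le.mp h
    rw [max_def, min_def]
    split_ifs <;> omega
  · rfl

/-- Consecutive points of the slide are equal or share a wall. [folklore] -/
theorem slide_step (a b : Pt d) (i : Fin d) (n : ℕ) :
    slide a b i n = slide a b i (n + 1) ∨ WallAdjacent (slide a b i n) (slide a b i (n + 1)) := by
  by_cases hlt : (n : ℤ) < |b i - a i|
  · right
    refine ⟨i, ?_, ?_⟩
    · have h' := lt_abs.mp hlt
      simp only [slide, Nat.cast_succ]
      rw [abs_eq (by norm_num : (0 : ℤ) ≤ 1)]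
      rw [max_def, max_def, min_def, min_def]
      split_ifs <;> omega
    · intro j hj
      simp only [slide, if_neg hj]
  · left
    push Not at hlt
    rw [slide_of_le a b i hlt, slide_of_le a b i (le_trans hlt (by exact_mod_cast Nat.le_succ n))]

/-- The slide stays coordinatewise between `a` and `b`. [folklore] -/
theorem slide_between (a b : Pt d) (i : Fin d) (n : ℕ) (j : Fin d) :
    min (a j) (b j) ≤ slide a b i n j ∧ slide a b i n j ≤ max (a j) (b j) := by
  unfold slide
  split_ifs with hj
  · rw [max_def, max_def, min_def, min_def]
    constructor <;> (split_ifs <;> omega)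
  · rw [max_def, min_def]
    constructor <;> (split_ifs <;> omega)

/-- `fixBelow` stays coordinatewise between `a` and `b`. [folklore] -/
theorem fixBelow_between (a b : Pt d) (k : ℕ) (j : Fin d) :
    min (a j) (b j) ≤ fixBelow a b k j ∧ fixBelow a b k j ≤ max (a j) (b j) := by
  unfold fixBelow
  rw [max_def, min_def]
  constructor <;> (split_ifs <;> omega)

/-- [folklore] -/
theorem fixBelow_zero (a b : Pt d) : fixBelow a b 0 = a := by
  funext j
  simp [fixBelow]

/-- [folklore] -/
theorem fixBelow_all (a b : Pt d) : fixBelow a b d = b := by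
  funext j
  simp [fixBelow, j.isLt]

/-- Setting coordinate `k` after the coordinates `< k` gives the coordinates `< k + 1`. [folklore] -/
theorem setI_fixBelow (a b : Pt d) {k : ℕ} (hk : k < d) :
    setI (fixBelow a b k) b ⟨k, hk⟩ = fixBelow a b (k + 1) := by
  funext j
  by_cases h : j = ⟨k, hk⟩
  · subst h
    simp [setI, fixBelow]
  · have hj : (j : ℕ) ≠ k := fun e => h (Fin.ext e)
    simp only [setI, fixBelow, if_neg h]
    by_cases h1 : (j : ℕ) < k
    · rw [if_pos h1, if_pos (by omega)]
    · rw [if_neg h1, if_neg (by omega)]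

/-- Inside a box, `a` is wall-connected to `a` with one coordinate set to that of `b`. [folklore] -/
theorem ibox_wconn_setI {lo hi a b : Pt d} (ha : a ∈ ibox lo hi) (hb : b ∈ ibox lo hi) (i : Fin d) :
    WConn (ibox lo hi) a (setI a b i) := by
  have hmem : ∀ n, slide a b i n ∈ ibox lo hi := fun n => ibox_between ha hb (slide_between a b i n)
  have key : ∀ n : ℕ, WConn (ibox lo hi) a (slide a b i n) := by
    intro n
    induction n with
    | zero => rw [slide_zero]; exact Relation.ReflTransGen.refl
    | succ n ih =>
        rcases slide_step a b i n with heq | hadj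
        · rw [← heq]; exact ih
        · exact Relation.ReflTransGen.tail ih ⟨hmem n, hmem (n + 1), hadj⟩
  have h := key (b i - a i).natAbs
  rwa [slide_of_le a b i (by rw [Int.natCast_natAbs])] at h

/-- **A box is wall-connected**: any two of its cubes are joined by a chain of cubes of the box, consecutive ones
sharing a wall. [folklore] -/
theorem ibox_wconn {lo hi a b : Pt d} (ha : a ∈ ibox lo hi) (hb : b ∈ ibox lo hi) : WConn (ibox lo hi) a b := by
  have hmem : ∀ k, fixBelow a b k ∈ ibox lo hi := fun k => ibox_between ha hb (fixBelow_between a b k)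
  have key : ∀ k : ℕ, k ≤ d → WConn (ibox lo hi) a (fixBelow a b k) := by
    intro k
    induction k with
    | zero => intro; rw [fixBelow_zero]; exact Relation.ReflTransGen.refl
    | succ k ih =>
        intro hk
        have hk' : k < d := by omega
        have h1 := ih (by omega)
        have h2 := ibox_wconn_setI (hmem k) hb ⟨k, hk'⟩
        rw [setI_fixBelow a b hk'] at h2
        exact h1.trans h2
  have h := key d le_rfl
  rwa [fixBelow_all] at h

/-! ## B. Wall-components: closed sets, monotonicity -/

/-- [folklore] -/
theorem mem_wComp_self (R : Set (Pt d)) (a : Pt d) : a ∈ wComp R a := Relation.ReflTransGen.refl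

/-- [folklore] -/
theorem wComp_subset {R : Set (Pt d)} {a : Pt d} (ha : a ∈ R) : wComp R a ⊆ R :=
  (wComp_subset_tComp R a).trans (tComp_subset ha)

/-- A set containing `a` and closed under wall steps inside `R` contains the wall-component of `a`. [folklore] -/
theorem wComp_subset_of_closed {R S : Set (Pt d)} {a : Pt d} (ha : a ∈ S)
    (hcl : ∀ x ∈ S, ∀ y ∈ R, WallAdjacent x y → y ∈ S) : wComp R a ⊆ S := by
  intro b hb
  induction hb with
  | refl => exact ha
  | tail _ hstep ih => exact hcl _ ih _ hstep.2.1 hstep.2.2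

/-- [folklore] -/
theorem WConn.mono {R R' : Set (Pt d)} (h : R ⊆ R') {a b : Pt d} (hab : WConn R a b) : WConn R' a b := by
  induction hab with
  | refl => exact Relation.ReflTransGen.refl
  | tail _ hstep ih => exact Relation.ReflTransGen.tail ih ⟨h hstep.1, h hstep.2.1, hstep.2.2⟩

/-! ## C. The replacement in the wall reading: single pass, (2.3), fixpoints, termination -/

/-- One simultaneous pass of the printed replacement, WALL-components. [cite: Balaban1988Convergent, p.251, p.269] -/
def passW (N : ℕ) (Z : Set (Pt d)) : Set (Pt d) :=
  {c | c ∈ Z ∨ ∃ a ∈ Z, FitsIn N (wComp Z a) ∧ c ∈ bbox (wComp Z a)}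

/-- The condition (2.3), WALL-components. [cite: Balaban1988Convergent, (2.3) p.255] -/
def Cond23W (N : ℕ) (Z : Set (Pt d)) : Prop := ∀ a ∈ Z, FitsIn N (wComp Z a) → IsBox (wComp Z a)

/-- [folklore] -/
theorem subset_passW (N : ℕ) (Z : Set (Pt d)) : Z ⊆ passW N Z := fun _ hc => Or.inl hc

/-- [folklore] -/
theorem passW_subset_ibox (N : ℕ) {Z : Set (Pt d)} {lo hi : Pt d} (hZ : Z ⊆ ibox lo hi) :
    passW N Z ⊆ ibox lo hi := by
  rintro c (hc | ⟨a, ha, _, hcb⟩)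
  · exact hZ hc
  · exact bbox_subset_ibox ((wComp_subset ha).trans hZ) hcb

/-- [folklore] -/
theorem passW_inflationary (N : ℕ) (lo hi : Pt d) :
    ∀ Z : Set (Pt d), Z ⊆ ibox lo hi → Z ⊆ passW N Z ∧ passW N Z ⊆ ibox lo hi :=
  fun Z hZ => ⟨subset_passW N Z, passW_subset_ibox N hZ⟩

/-- If the bounding box of a finite wall-component lies in `Z`, the component fills it (boxes are wall-connected).
[folklore] -/
theorem bbox_subset_wComp {Z : Set (Pt d)} {a : Pt d} (hK : bbox (wComp Z a) ⊆ Z)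
    (hfin : (wComp Z a).Finite) : bbox (wComp Z a) ⊆ wComp Z a := by
  obtain ⟨lo, hi, hb⟩ := bbox_isBox hfin ⟨a, mem_wComp_self Z a⟩
  intro c hc
  have haB : a ∈ ibox lo hi := by rw [← hb]; exact subset_bbox _ (mem_wComp_self Z a)
  have hcB : c ∈ ibox lo hi := by rw [← hb]; exact hc
  have hBZ : ibox lo hi ⊆ Z := by rw [← hb]; exact hK
  exact WConn.mono hBZ (ibox_wconn haB hcB)

/-- **At a fixpoint of the wall pass, (2.3) (wall reading) holds.** [cite: Balaban1988Convergent, (2.3) p.255] -/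
theorem cond23W_of_fixpoint {N : ℕ} {Z : Set (Pt d)} (hfix : passW N Z = Z) : Cond23W N Z := by
  intro a ha hfit
  have hfin : (wComp Z a).Finite := hfit.finite
  have hK : bbox (wComp Z a) ⊆ Z := by
    intro c hc
    have : c ∈ passW N Z := Or.inr ⟨a, ha, hfit, hc⟩
    rwa [hfix] at this
  have heq : bbox (wComp Z a) = wComp Z a :=
    Set.Subset.antisymm (bbox_subset_wComp hK hfin) (subset_bbox _)
  obtain ⟨lo, hi, hb⟩ := bbox_isBox hfin ⟨a, mem_wComp_self Z a⟩
  exact ⟨lo, hi, by rw [← heq, hb]⟩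

/-- **The repaired operation, wall reading**: `#A` passes inside a box `A ⊇ Z` reach a fixpoint …
[folklore] -/
theorem passW_iterate_fixpoint (N : ℕ) {lo hi : Pt d} {Z : Set (Pt d)} (hZ : Z ⊆ ibox lo hi) :
    passW N ((passW N)^[(ibox lo hi).ncard] Z) = (passW N)^[(ibox lo hi).ncard] Z :=
  iterate_fix (ibox lo hi) (ibox_finite lo hi) (passW N) (passW_inflationary N lo hi) Z hZ

/-- … containing `Z`, inside `A` … [folklore] -/
theorem subset_passW_iterate (N n : ℕ) {lo hi : Pt d} {Z : Set (Pt d)} (hZ : Z ⊆ ibox lo hi) :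
    Z ⊆ (passW N)^[n] Z ∧ (passW N)^[n] Z ⊆ ibox lo hi := by
  induction n with
  | zero => exact ⟨subset_rfl, hZ⟩
  | succ n ih =>
      rw [Function.iterate_succ_apply']
      exact ⟨ih.1.trans (subset_passW N _), passW_subset_ibox N ih.2⟩

/-- … and satisfying (2.3) in the wall reading. [cite: Balaban1988Convergent, (2.3) p.255] -/
theorem cond23W_iterate (N : ℕ) {lo hi : Pt d} {Z : Set (Pt d)} (hZ : Z ⊆ ibox lo hi) :
    Cond23W N ((passW N)^[(ibox lo hi).ncard] Z) :=
  cond23W_of_fixpoint (passW_iterate_fixpoint N hZ)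

/-! ## D. A single pass fails in the wall reading: the `d = 2` slice of the referee's wall example -/

/-- `K2w = [5,7]×[2,4]`. [folklore] -/
def K2w : Set (Pt 2) := {c | 5 ≤ c 0 ∧ c 0 ≤ 7 ∧ 2 ≤ c 1 ∧ c 1 ≤ 4}

/-- `Z0w = K1 ∪ K2w` (before the pass). [folklore] -/
def Z0w : Set (Pt 2) := K1 ∪ K2w

/-- `Z1w = [−1,4]² ∪ [5,7]×[2,4]` (after one pass). [folklore] -/
def Z1w : Set (Pt 2) := B1 ∪ K2w

/-- `K2w` is the one-layer enlargement of the cube `(6,3)` (the referee's fourth cube). [folklore] -/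
theorem K2w_eq_ienl : K2w = ienl ({![6, 3]} : Set (Pt 2)) := by
  ext c
  simp only [K2w, ienl, Touching, Set.mem_setOf_eq, Set.mem_singleton_iff, exists_eq_left, Fin.forall_fin_two,
    Matrix.cons_val_zero, Matrix.cons_val_one, abs_le]
  omega

/-- [folklore] -/
theorem K2w_eq_ibox : K2w = ibox ![5, 2] ![7, 4] := by
  ext c
  simp only [K2w, Set.mem_setOf_eq, mem_ibox_two, Matrix.cons_val_zero, Matrix.cons_val_one]

/-- Wall adjacency in `d = 2`, unfolded. [folklore] -/
theorem wallAdjacent_two {x y : Pt 2} (h : WallAdjacent x y) :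
    ((x 0 - y 0 = 1 ∨ x 0 - y 0 = -1) ∧ x 1 = y 1) ∨ ((x 1 - y 1 = 1 ∨ x 1 - y 1 = -1) ∧ x 0 = y 0) := by
  rw [WallAdjacent, Fin.exists_fin_two] at h
  rcases h with ⟨h0, hr⟩ | ⟨h1, hr⟩
  · exact Or.inl ⟨(abs_eq (by norm_num : (0 : ℤ) ≤ 1)).mp h0, (hr 1 (by decide)).symm ▸ rfl⟩
  · exact Or.inr ⟨(abs_eq (by norm_num : (0 : ℤ) ≤ 1)).mp h1, (hr 0 (by decide)).symm ▸ rfl⟩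

/-- Before the pass the cubes `(4,1) ∈ K1` and `(5,2) ∈ K2w` touch only at a corner (so in the TOUCHING reading
`Z0w` is already one component; the wall example is specific to the wall reading). [folklore] -/
theorem corner_41_52 : Touching (![4, 1] : Pt 2) ![5, 2] ∧ ¬ WallAdjacent (![4, 1] : Pt 2) ![5, 2] := by
  constructor
  · rw [Touching, Fin.forall_fin_two]
    simp
  · intro h
    rcases wallAdjacent_two h with ⟨_, h1⟩ | ⟨_, h0⟩
    · simp at h1
    · simp at h0

/-- `K1` is closed under wall steps inside `Z0w`. [folklore] -/
theorem K1_wclosed : ∀ x ∈ K1, ∀ y ∈ Z0w, WallAdjacent x y → y ∈ K1 := by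
  intro x hx y hy hxy
  rcases hy with hy | hy
  · exact hy
  · exfalso
    have h := wallAdjacent_two hxy
    simp only [K1, K2w, Set.mem_setOf_eq] at hx hy
    omega

/-- `K2w` is closed under wall steps inside `Z0w`. [folklore] -/
theorem K2w_wclosed : ∀ x ∈ K2w, ∀ y ∈ Z0w, WallAdjacent x y → y ∈ K2w := by
  intro x hx y hy hxy
  rcases hy with hy | hy
  · exfalso
    have h := wallAdjacent_two hxy
    simp only [K1, K2w, Set.mem_setOf_eq] at hx hy
    omega
  · exact hy

/-- `K1` is wall-connected (two boxes through the origin). [folklore] -/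
theorem K1_wconn {a c : Pt 2} (ha : a ∈ K1) (hc : c ∈ K1) : WConn K1 a c := by
  have ho1 : (![0, 0] : Pt 2) ∈ ibox ![-1, -1] ![1, 4] := by simp [mem_ibox_two]
  have ho2 : (![0, 0] : Pt 2) ∈ ibox ![-1, -1] ![4, 1] := by simp [mem_ibox_two]
  have hs1 : ibox ![-1, -1] ![1, 4] ⊆ K1 := by rw [K1_eq_union]; exact Set.subset_union_left
  have hs2 : ibox ![-1, -1] ![4, 1] ⊆ K1 := by rw [K1_eq_union]; exact Set.subset_union_right
  have h1 : WConn K1 a ![0, 0] := by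
    rw [K1_eq_union] at ha
    rcases ha with ha | ha
    · exact WConn.mono hs1 (ibox_wconn ha ho1)
    · exact WConn.mono hs2 (ibox_wconn ha ho2)
  have h2 : WConn K1 ![0, 0] c := by
    rw [K1_eq_union] at hc
    rcases hc with hc | hc
    · exact WConn.mono hs1 (ibox_wconn ho1 hc)
    · exact WConn.mono hs2 (ibox_wconn ho2 hc)
  exact h1.trans h2

/-- **The wall-components of `Z0w` are `K1` and `K2w`.** [folklore] -/
theorem wComp_Z0w_of_mem_K1 {a : Pt 2} (ha : a ∈ K1) : wComp Z0w a = K1 := by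
  refine Set.Subset.antisymm (wComp_subset_of_closed ha K1_wclosed) ?_
  intro c hc
  exact WConn.mono (Set.subset_union_left : K1 ⊆ Z0w) (K1_wconn ha hc)

/-- [folklore] -/
theorem wComp_Z0w_of_mem_K2w {a : Pt 2} (ha : a ∈ K2w) : wComp Z0w a = K2w := by
  refine Set.Subset.antisymm (wComp_subset_of_closed ha K2w_wclosed) ?_
  intro c hc
  rw [K2w_eq_ibox] at ha hc
  have h := ibox_wconn ha hc
  rw [← K2w_eq_ibox] at h
  exact WConn.mono (Set.subset_union_right : K2w ⊆ Z0w) h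

/-- `K2w` fits in a `3`-cube. [folklore] -/
theorem K2w_fitsIn : FitsIn 3 K2w := by
  refine ⟨![5, 2], fun c hc => ?_⟩
  rw [mem_ibox_two]
  simp only [K2w, Set.mem_setOf_eq] at hc
  simp only [Matrix.cons_val_zero, Matrix.cons_val_one]
  omega

/-- [folklore] -/
theorem bbox_K2w : bbox K2w = K2w := by
  rw [K2w_eq_ibox, bbox_ibox]

/-- **The single wall pass on `Z0w` yields `Z1w`** (any `N ≥ 6`). [cite: Balaban1988Convergent, p.251] -/
theorem passW_Z0w {N : ℕ} (hN : 6 ≤ N) : passW N Z0w = Z1w := by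
  ext c
  constructor
  · rintro (hc | ⟨a, ha, _, hcb⟩)
    · rcases hc with hc | hc
      · left
        have := subset_bbox K1 hc
        rwa [bbox_K1] at this
      · exact Or.inr hc
    · rcases ha with ha | ha
      · rw [wComp_Z0w_of_mem_K1 ha, bbox_K1] at hcb
        exact Or.inl hcb
      · rw [wComp_Z0w_of_mem_K2w ha, bbox_K2w] at hcb
        exact Or.inr hcb
  · rintro (hc | hc)
    · have m0 : (![0, 0] : Pt 2) ∈ K1 := by simp [K1]
      refine Or.inr ⟨![0, 0], Or.inl m0, ?_, ?_⟩
      · rw [wComp_Z0w_of_mem_K1 m0]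
        exact K1_fitsIn.mono hN
      · rw [wComp_Z0w_of_mem_K1 m0, bbox_K1]
        exact hc
    · exact Or.inl (Or.inr hc)

/-- After the pass `(4,2) ∈ [−1,4]²` and `(5,2) ∈ K2w` share a wall: **`Z1w` is ONE wall-component**. [folklore] -/
theorem wComp_Z1w : wComp Z1w ![0, 0] = Z1w := by
  have m0 : (![0, 0] : Pt 2) ∈ B1 := by simp [B1]
  refine Set.Subset.antisymm (wComp_subset (Or.inl m0)) ?_
  have hB1 : B1 ⊆ Z1w := Set.subset_union_left
  have hK2 : K2w ⊆ Z1w := Set.subset_union_right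
  have m42 : (![4, 2] : Pt 2) ∈ B1 := by simp [B1]
  have m52 : (![5, 2] : Pt 2) ∈ K2w := by simp [K2w]
  have hwall : WallAdjacent (![4, 2] : Pt 2) ![5, 2] := by
    rw [WallAdjacent, Fin.exists_fin_two]
    left
    refine ⟨by simp, ?_⟩
    rw [Fin.forall_fin_two]
    simp
  have h04 : WConn Z1w ![0, 0] ![4, 2] := by
    rw [B1_eq_ibox] at m0 m42
    have h := ibox_wconn m0 m42
    rw [← B1_eq_ibox] at h
    exact WConn.mono hB1 h
  have h05 : WConn Z1w ![0, 0] ![5, 2] := Relation.ReflTransGen.tail h04 ⟨hB1 m42, hK2 m52, hwall⟩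
  intro c hc
  rcases hc with hc | hc
  · rw [B1_eq_ibox] at m0 hc
    have h := ibox_wconn m0 hc
    rw [← B1_eq_ibox] at h
    exact WConn.mono hB1 h
  · rw [K2w_eq_ibox] at m52 hc
    have h := ibox_wconn m52 hc
    rw [← K2w_eq_ibox] at h
    exact h05.trans (WConn.mono hK2 h)

/-- `Z1w` fits in a `9`-cube. [folklore] -/
theorem Z1w_fitsIn : FitsIn 9 Z1w := by
  refine ⟨![-1, -1], fun c hc => ?_⟩
  rw [mem_ibox_two]
  rcases hc with hc | hc <;> simp only [B1, K2w, Set.mem_setOf_eq] at hc <;>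
    simp only [Matrix.cons_val_zero, Matrix.cons_val_one] <;> omega

/-- **`Z1w` is not a rectangular parallelepiped** (`(−1,−1), (7,4) ∈ Z1w`, `(7,−1) ∉ Z1w`). [folklore] -/
theorem Z1w_not_box : ¬ IsBox Z1w := by
  rintro ⟨lo, hi, h⟩
  have m1 : (![-1, -1] : Pt 2) ∈ Z1w := Or.inl (by simp [B1])
  have m2 : (![7, 4] : Pt 2) ∈ Z1w := Or.inr (by simp [K2w])
  have m3 : (![7, -1] : Pt 2) ∉ Z1w := by
    rintro (h3 | h3)
    · simp [B1] at h3
    · simp [K2w] at h3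
  rw [h, mem_ibox_two] at m1 m2 m3
  simp only [Matrix.cons_val_zero, Matrix.cons_val_one] at m1 m2 m3
  omega

/-- **A single pass does not produce (2.3) in the wall reading either**: for every `N ≥ 9` (printed `100`),
`passW N Z0w` has a wall-component inside an `N`-cube that is not a box.  With `…B14BoxFix.single_pass_fails` the
referee's G-adv5-9 holds under both connectivity readings. [cite: Balaban1988Convergent, p.251, (2.3) p.255, p.269] -/
theorem single_passW_fails {N : ℕ} (hN : 9 ≤ N) : ¬ Cond23W N (passW N Z0w) := by
  intro h
  rw [passW_Z0w (by omega)] at h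
  have m0 : (![0, 0] : Pt 2) ∈ Z1w := Or.inl (by simp [B1])
  have hbox := h ![0, 0] m0 (by rw [wComp_Z1w]; exact Z1w_fitsIn.mono hN)
  rw [wComp_Z1w] at hbox
  exact Z1w_not_box hbox

end Literature.MathematicalPhysics.QuantumFieldTheory.Balaban1983to89.B14BoxFixWall
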